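import Summits.QuantumFields.BalabanUV.T4Continuum.Spine.NE1p.DressedStabilityStrictOfSuppliedComposition
import Summits.QuantumFields.BalabanUV.T4Continuum.Spine.NE1p.DressedValueMapWitness

/-!
# T⁴ programme, spine estimate NE1′ (node O3b/H2) — crew row W32: THE SUPPLIED COMPOSITION ENDs FIRE (row S3u §2's END-ALL ∘ SUPPLIERS
# on W18's `towerC` through W20's value map; count READ OFF an anchoring at `Lb = 2`; births READ THROUGH an ℝ-step; absorption CLOSED BY THEOREM)

Cell `pub-balaban`, sub-cell `t4`, BINDER-OWNERS row NE1′, crew `b2b-balaban-t4-ne1p-formalise-*`, seat `leaf-02` (gen 12; lineage S3i ∕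
S5e ∕ W8 — the suppliers and their booking-level (α′) witness).  ADDITIVE — imports row S3u `Spine/NE1p/DressedStabilityStrictOfSuppliedComposition`
(p218916: the three supplied ENDs) and row W20 `Spine/NE1p/DressedValueMapWitness` (p219129: `vmap`, `hVK_C`, `hVrel_C`, `hneX_C`, `hsupX_C`,
`hG_C`; through it W18 `DressedCompositionWitness` p218795: `towerC`∕`BC`∕`TC`∕`SC`∕`FnC`∕`gC`∕`hinv_C`∕`hreg_C`) ONLY; toy DATA `def`s +
theorems; nothing of S3u ∕ W18 ∕ W20 ∕ S3i ∕ S5e is restated.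

WHY.  Row S3u §2 is the crew's END-ALL ∘ SUPPLIERS service on the (γ) END OF RECORD (N0e's `dressedStabilityStrict_of_composition`
with `hS`∕`hcount` SUPPLIED by an anchoring — S3i `count_of_anchoring_cell` —, `hbirth` SUPPLIED through the ℝ-step anchored seam — S5e
`hbirth_of_rstep_anchored` —, `hsl`∕`hdefw`∕`hrate`∕`hlin` by §1's value-map socket).  Its three ENDs had NO applier (W20 fires the §1
SOCKET but feeds N0e with W18's STRUCTURAL `hS_C`∕`hcount_C`∕`hbirth_C`; X92 INFO-3, X94 INFO-2).  THIS FILE applies them once each on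
W18's datum UNCHANGED: §1 `SA` = W18's live sets CAPPED AT THE CUTOFF (`∅` above `K` — housing needs a cube of the step's scale; W17's
`SD` did the same) + the bridge `ranBelow_SC_of_SA` (the dressed gates AGREE at every step `≤ K`, `budgetGate` reads `S k` only) through
which W18∕W20's gate-indexed binders transfer BY NAME; §2 THE ANCHORING `anchC K : Anchoring (BC K) 4 2` (domains = the ORIGIN BLOCK of
the birth scale, `felt_under` by `0 / 2^n = 0`; multiplicity `mB = 1` and component volume `v = 1` ATTAINED, housing GENUINE) — W18's
posited `N₀ = 1` is DERIVED as `v·mB`; §3 THE ℝ-STEP `RsC K` (`pre` := the transported envelope, an EQUALITY seam as W30's; `CompVol 1`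
attained; `absorbs := ∅`; dressing `βC K j = (2⁻¹)³^(K−j)`, `hβ` at `β₀ = 1` and `absorbLaw_RsC` at `A = 0` with EQUALITY — W18's births
sit ON the class); §4 THE END `suppliedComposition_fires` = (multiplicity, volume, housing live) ∧ `DressedStabilityStrict towerC ((2:ℝ)^4)`
by `dressedStabilityStrict_of_suppliedComposition` BY NAME, ONE application (conjoined: the bare ROOT-C on `towerC` is W18's,
`dedup.landed`), then the headline END and the ROOT-B END (`1 ≤ v`) once each as `example`s; §5 THE ABSORPTION DOOR IS CLOSED ON
`towerC` BY THEOREM, NOT BY CHOICE: for ANY supplier data on this datum `one_le_mB_of_anchoring`, `one_le_v_of_housing`,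
`beta0_ge_one_of_absorbLaw` (the OLDEST family absorbs nobody by `RStep.absorbs_lt`, births ON the class), `A0_le_one_of_window` (W18's
pinned `m = ½`, `s₀ ≡ 0`, `locOf 2 1 4 c̄ ≤ ρ′ < 1`, with `1 ≤ N₀`) and `absorption_weightless` (`fanout < 1 ∧ absorbAmplitude ≤ A₀ ≤ 1 ≤ β₀
⇒ A·N = 0`): through row S5b's located window the absorbed pre-mass carries ZERO weight here — `absorbs := ∅, A := 0` is the only
admissible corner; the located DESIGN CONSTRAINT for a genuine (γ)-side absorption witness is window ROOM `m·N₀·A₀·(1−ρ′)⁻¹ < 1 − s̄⁰`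
with births strictly INSIDE the class (W18 is TIGHT) — not this file (W30 reads a genuine `RStep` on (α′)).
LIVE: anchoring (`felt_under` used, multiplicity∕volume attained, `N₀` derived), housing, the ℝ-step's `pre` (`pre_pos`, equality seam),
`CompVol`, the value map (W20); CLOSED (declared, forced by §5): `absorbs`, `A`; (w5) idle as in W18.  Planted mutants (NOT filed; rc 1
each): `SA := SC` (housing above `K`), `dom := ∅` (`felt_under`), `βC` halved (`absorbLaw_RsC`), `A := 1∕8` (`hamp` — §5 in action).

HONEST FRAMING (c4; typer R-T109 (ii)(g), ADOPTED verbatim).  «The (γ)-route END-ALL ∘ SUPPLIERS of row S3u §2 composes BY NAME at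
function level on W18's decided datum (Lb = L = 2); `Anchoring` (row S3i) and `RStep` (row O3.E-iii-c `T4PreservedUnderR.RStep`) are the
crew's SHAPES, and the anchoring's `dom`∕`center` and the ℝ-step's `pre` are DEFINED so that the seams are equalities — W32 certifies
SOCKET COMPOSITION and records a located DESIGN CONSTRAINT (absorption weightless on a births-on-the-class datum), NOT that an
ℝ-operation ∕ minimisers ∕ components of [Balaban1989LargeFieldII] were constructed or bounded; S3v's supplied ENDs untouched; discharges
no wall item; R-t4r2-Q2 NOT met thereby; NE1′ NOT proved.»  A toy on the complex line with the origin-block anchoring; (VAL-θ), (w1),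
(w5)∕(w5b), (I4′), PAY untouched.  [decided toy] ∕ [folklore]; 0 `def … : Prop`; no placeholders; 0 citations (the bracketed paper
name above is the rider's wording, no locus used).  NE1′ NOT printed, NOT proved; spine PROVED 0∕9; count 9 unchanged.  Rung (B)+1 on
ONE finite four-torus — NOT infinite volume, NOT a mass gap, NOT OS on ℝ⁴, NOT Clay.  HONEST DEPENDENCY: continuum YM on T⁴ ⇐ BetaPertH
∧ nine spine estimates (0/9 proved); BetaPertH ⇐ (D1) ∧ (D4) ∧ CAP+tail; G-an2-4 gates asym, D1 and NE2/3/4.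
-/

noncomputable section

namespace Summit.QuantumFields.BalabanUV.T4Continuum.NE1p.DressedSuppliedCompositionWitness

open Set Metric Finset
open scoped BigOperators
open Literature.MathematicalPhysics.QuantumFieldTheory.Balaban1983to89
open Literature.MathematicalPhysics.QuantumFieldTheory.Balaban1983to89.T4TermFormat
open Literature.MathematicalPhysics.QuantumFieldTheory.Balaban1983to89.T4FeltGeometry
open Literature.MathematicalPhysics.QuantumFieldTheory.Balaban1983to89.T4TrajectoryComparison
open Literature.MathematicalPhysics.QuantumFieldTheory.Balaban1983to89.T4BirthChartTransport (GaugeInvariant BirthSlice RelGauge)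
open Literature.MathematicalPhysics.QuantumFieldTheory.Balaban1983to89.T4PreservedUnderR (RStep)
open Summit.QuantumFields.BalabanUV.T4Continuum.T4TrajectoryDensityDressed
open Summit.QuantumFields.BalabanUV.T4Continuum.NE1p.DressedRoot
open Summit.QuantumFields.BalabanUV.T4Continuum.NE1p.DressedUniformConstants
open Summit.QuantumFields.BalabanUV.T4Continuum.NE1p.DressedAbsorptionWindow
open Summit.QuantumFields.BalabanUV.T4Continuum.NE1p.DressedRootComposition
open Summit.QuantumFields.BalabanUV.T4Continuum.NE1p.DressedStabilityStrictOfSuppliedComposition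
open Summit.QuantumFields.BalabanUV.T4Continuum.NE1p.DressedCompositionWitness
open Summit.QuantumFields.BalabanUV.T4Continuum.NE1p.DressedValueMapWitness

/-! ## §1 W18's live sets capped at the cutoff; the two dressed gates agree below it -/

/-- THE LIVE FAMILIES of a step-`k` component, CAPPED AT THE CUTOFF [decided toy]: W18's `SC K k b` for `k ≤ K`, `∅` above `K`. [folklore] -/
def SA (K k : ℕ) (b : Fin (K + 1)) : Finset (Fin (K + 1)) := if k ≤ K then SC K k b else ∅

/-- Below the cutoff the capped live sets ARE W18's. [folklore] -/
theorem SA_of_le {K k : ℕ} (hk : k ≤ K) (b : Fin (K + 1)) : SA K k b = SC K k b := if_pos hk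

/-- **THE BRIDGE** [bookkeeping]: `budgetGate` reads the live sets of the CURRENT step only, so a history below a step `k ≤ K` under the
capped live sets IS a history under W18's live sets (any margins, source factor, constant, rates). [folklore] -/
theorem ranBelow_SC_of_SA (K : ℕ) {s₀ : (BC K).Birth → ℕ → ℝ} {m C : ℝ} {ρ : ℕ → ℝ} {k : ℕ} (hk : k ≤ K)
    (h : RanBelow (budgetGate (TC K) s₀ m (SA K) C ρ) k) : RanBelow (budgetGate (TC K) s₀ m (SC K) C ρ) k := by
  intro i hi b hb
  have h' := h i hi b hb
  rwa [SA_of_le (show i ≤ K by omega)] at h'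

/-- (w1) F-1 AT BIRTH under the capped gate: W20's `hG_C` through the bridge. [folklore] -/
theorem hG_A (K : ℕ) : ∀ (b : (BC K).Birth) (k' : ℕ), (BC K).birthScale b ≤ k' → k' ≤ (BC K).K →
    RanBelow (budgetGate (TC K) (fun _ _ => (0 : ℝ)) (1 / 2) (SA K) (4 * 1 / 1) (fun _ : ℕ => ((2 : ℝ) ^ 2)⁻¹ * 1)) k' →
    BirthSlice (FnC K b k' k') (fun U d t => U + t * d) (fun d : ℂ => ‖d‖) (closedBall (0 : ℂ) 1) 1 1 ((TC K).gen b k') :=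
  fun b k' hb hk' hran => hG_C K b k' hb hk' (ranBelow_SC_of_SA K hk' hran)

/-- F-8's admissible unit pairs under the capped gate: W20's `hneX_C` through the bridge. [folklore] -/
theorem hneX_A (K : ℕ) : ∀ (b : (BC K).Birth) (k' k : ℕ), (BC K).birthScale b ≤ k' → k' ≤ k → k ≤ (BC K).K →
    RanBelow (budgetGate (TC K) (fun _ _ => (0 : ℝ)) (1 / 2) (SA K) (4 * 1 / 1) (fun _ : ℕ => ((2 : ℝ) ^ 2)⁻¹ * 1)) k →
    ∃ X₀ ∈ closedBall (0 : ℂ) 1, ∃ X₁ : ℂ,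
      RelGauge (fun U U' : ℂ => U = U') (fun U d t => U + t * d) (fun d : ℂ => ‖d‖) X₀ X₁ ((fun _ : ℕ => (1 : ℝ)) k) :=
  fun b k' k hb hk' hk hran => hneX_C K b k' k hb hk' hk (ranBelow_SC_of_SA K hk hran)

/-- F-8's booking convention on unit pairs under the capped gate: W20's `hsupX_C` through the bridge. [folklore] -/
theorem hsupX_A (K : ℕ) : ∀ (b : (BC K).Birth) (k' k : ℕ), (BC K).birthScale b ≤ k' → k' ≤ k → k ≤ (BC K).K →
    RanBelow (budgetGate (TC K) (fun _ _ => (0 : ℝ)) (1 / 2) (SA K) (4 * 1 / 1) (fun _ : ℕ => ((2 : ℝ) ^ 2)⁻¹ * 1)) k →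
    (TC K).lin b k' k ≤ sSup {x : ℝ | ∃ X₀ ∈ closedBall (0 : ℂ) 1, ∃ X₁ : ℂ,
      RelGauge (fun U U' : ℂ => U = U') (fun U d t => U + t * d) (fun d : ℂ => ‖d‖) X₀ X₁ ((fun _ : ℕ => (1 : ℝ)) k) ∧
        x = ‖FnC K b k' k' (vmap k' k X₁) - FnC K b k' k' (vmap k' k X₀)‖} :=
  fun b k' k hb hk' hk hran => hsupX_C K b k' k hb hk' hk (ranBelow_SC_of_SA K hk hran)

/-- (w5) regeneration under the capped gate: W18's `hreg_C` through the bridge (idle on this toy, as in W18). [folklore] -/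
theorem hreg_A (K : ℕ) : (TC K).RegeneratesFromVar (fun _ : ℕ => (0 : ℝ))
    (budgetGate (TC K) (fun _ _ => (0 : ℝ)) (1 / 2) (SA K) (4 * 1 / 1) (fun _ : ℕ => ((2 : ℝ) ^ 2)⁻¹ * 1)) :=
  fun b k hbk hkK hran => hreg_C K b k hbk hkK (ranBelow_SC_of_SA K (by exact hkK) hran)

/-! ## §2 The anchoring of `BC K` on `ℕ⁴` at the blocking integer `2`; components; housing -/

/-- THE ANCHORING [decided toy]: domains and cube blocks = the ORIGIN BLOCK of their scale; `felt_under` by `0 / 2^n = 0`. [folklore] -/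
def anchC (K : ℕ) : Anchoring (BC K) 4 2 where
  dom := fun _ => {0}
  center := fun _ => 0
  felt_under := fun q b _ => ⟨0, mem_singleton_self _, funext fun i => by simp [coarsen]⟩

/-- `hmult`: per-block multiplicity `mB = 1` — at most ONE family has a given birth scale. [folklore] -/
theorem hmult_A (K : ℕ) : ∀ (j : ℕ) (x : Fin 4 → ℕ),
    ((BC K).births.filter fun b => (BC K).birthScale b = j ∧ x ∈ (anchC K).dom b).card ≤ 1 :=
  fun _ _ => card_le_one.mpr fun _ hf _ hf' =>
    Fin.ext (((mem_filter.mp hf).2.1).trans ((mem_filter.mp hf').2.1).symm)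

/-- **THE MULTIPLICITY IS ATTAINED** [decided toy]: at the origin block, for every birth scale `j ≤ K`, EXACTLY one family is anchored. [folklore] -/
theorem hmult_attained (K : ℕ) {j : ℕ} (hj : j ≤ K) :
    ((BC K).births.filter fun b => (BC K).birthScale b = j ∧ (0 : Fin 4 → ℕ) ∈ (anchC K).dom b).card = 1 := by
  refine card_eq_one.mpr ⟨⟨j, Nat.lt_succ_of_le hj⟩, eq_singleton_iff_unique_mem.mpr ⟨?_, fun f hf => ?_⟩⟩
  · exact mem_filter.mpr ⟨(BC K).mem_births _, rfl, mem_singleton_self _⟩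
  · exact Fin.ext (mem_filter.mp hf).2.1

/-- THE COMPONENT of a step-`k` family [decided toy]: THE cube of scale `k` (none above the cutoff). [folklore] -/
def compA (K k : ℕ) (_b : Fin (K + 1)) : Finset (Fin (K + 1)) := Finset.univ.filter fun q : Fin (K + 1) => q.val = k

/-- `hscale`: component cubes have the step's scale. [folklore] -/
theorem hscale_A (K : ℕ) : ∀ k (b : (BC K).Birth), ∀ q ∈ compA K k b, (BC K).cubeScale q = k :=
  fun _ _ _ hq => (mem_filter.mp hq).2

/-- `hvol`: component volume `v = 1`. [folklore] -/
theorem hvol_A (K : ℕ) : ∀ k (b : (BC K).Birth), (compA K k b).card ≤ 1 :=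
  fun _ _ => card_le_one.mpr fun _ hq _ hq' => Fin.ext (((mem_filter.mp hq).2).trans ((mem_filter.mp hq').2).symm)

/-- **THE VOLUME IS ATTAINED** [decided toy]: below the cutoff the component has EXACTLY one cube. [folklore] -/
theorem hvol_attained (K : ℕ) {k : ℕ} (hk : k ≤ K) (b : (BC K).Birth) : (compA K k b).card = 1 :=
  card_eq_one.mpr ⟨⟨k, Nat.lt_succ_of_le hk⟩, eq_singleton_iff_unique_mem.mpr
    ⟨mem_filter.mpr ⟨Finset.mem_univ _, rfl⟩, fun _ hq => Fin.ext (mem_filter.mp hq).2⟩⟩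

/-- **HOUSING, GENUINE** [decided toy]: every live family of a step-`k` component (`f ≤ k ≤ K`) IS felt at the component's cube
(W18's `feltAt q` = the families born at scales `≤` the cube's); above the cutoff the live set is empty. [folklore] -/
theorem hhoused_A (K : ℕ) : ∀ k (b : (BC K).Birth), ∀ f ∈ SA K k b, ∃ q ∈ compA K k b, f ∈ (BC K).feltAt q := by
  intro k b f hf
  unfold SA at hf
  split_ifs at hf with hk
  · exact ⟨⟨k, Nat.lt_succ_of_le hk⟩, mem_filter.mpr ⟨Finset.mem_univ _, rfl⟩,
      mem_filter.mpr ⟨Finset.mem_univ _, (mem_filter.mp hf).2⟩⟩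
  · exact absurd hf (Finset.notMem_empty f)

/-! ## §3 The ℝ-step datum: pre-sizes = the transported envelope, one-cube components, no absorption, dressing = the birth size -/

/-- PRE-ℝ SIZE of `b` before the ℝ-operation of scale `k` [decided toy]: the rate times the dressed envelope at `k−1` (EQUALITY seam). [folklore] -/
def preC (K : ℕ) (b : Fin (K + 1)) (k : ℕ) : ℝ :=
  (((2 : ℝ) ^ 2)⁻¹ * 1) * (TC K).envVar (4 * 1 / 1) (fun _ : ℕ => ((2 : ℝ) ^ 2)⁻¹ * 1) b (k - 1)

/-- DRESSING SIZES [decided toy]: `βC K j = (2⁻¹)³^(K−j)` — the whole class at birth (`β₀ = 1`, `τ = L⁻³ = 1∕8`). [folklore] -/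
def βC (K j : ℕ) : ℝ := ((2 : ℝ)⁻¹ ^ 3) ^ (K - j)

/-- THE ℝ-STEP DATUM over `BC K` [decided toy]: `pre = preC`, component = the cube of the birth scale, `absorbs = ∅` (§5), `δ = βC`. [folklore] -/
def RsC (K : ℕ) : RStep (BC K) where
  pre := preC K
  pre_nonneg := fun b k => mul_nonneg (by norm_num)
    (Trajectory.envVar_nonneg (by norm_num) (fun _ => by norm_num) b (k - 1))
  absorbs := fun _ => ∅
  absorbs_lt := fun _ _ h => absurd h (Finset.notMem_empty _)
  comp := fun b => {b}
  comp_scale := fun b q hq => by rw [Finset.mem_singleton.mp hq]; rfl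
  absorbs_felt := fun _ _ h => absurd h (Finset.notMem_empty _)
  δ := fun b => βC K b.val
  δ_nonneg := fun b => by unfold βC; positivity

/-- `hcv`: component volume `vR = 1`, ATTAINED (singletons). [folklore] -/
theorem compVol_RsC (K : ℕ) : (RsC K).CompVol 1 := fun _ => (Finset.card_singleton _).le

/-- **THE SEAM AS AN EQUALITY** [decided toy]: the pre-ℝ size at `k+1` IS the rate times the dressed envelope at `k`. [folklore] -/
theorem preBelowEnv_eq (K : ℕ) (b : (BC K).Birth) (k : ℕ) :
    (RsC K).pre b (k + 1) = (((2 : ℝ) ^ 2)⁻¹ * 1) * (TC K).envVar (4 * 1 / 1) (fun _ : ℕ => ((2 : ℝ) ^ 2)⁻¹ * 1) b k := by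
  show preC K b (k + 1) = _
  unfold preC
  rw [Nat.add_sub_cancel]

/-- `hpre` — PRE-SIZES BELOW THE TRANSPORTED ENVELOPE under the capped dressed gate (indeed EQUAL to it; any gate). [folklore] -/
theorem preBelowEnv_RsC (K : ℕ) (Gate : ℕ → Prop) :
    (TC K).PreBelowEnv (RsC K) (4 * 1 / 1) (fun _ : ℕ => ((2 : ℝ) ^ 2)⁻¹ * 1) Gate :=
  fun b k _ _ _ => (preBelowEnv_eq K b k).le

/-- The pre-ℝ size one step after birth is POSITIVE (the seam is live, not `≡ 0`): `ψ·(4·gen b b) = ¼·(1∕8)^(K−b)`. [folklore] -/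
theorem pre_pos (K : ℕ) (b : (BC K).Birth) : 0 < (RsC K).pre b ((BC K).birthScale b + 1) := by
  rw [preBelowEnv_eq, Trajectory.envVar_birth]
  show (0 : ℝ) < ((2 : ℝ) ^ 2)⁻¹ * 1 * (4 * 1 / 1 * (if b.val = b.val then 3 * gC K b.val else 0))
  rw [if_pos rfl]
  exact mul_pos (by norm_num) (mul_pos (by norm_num) (mul_pos (by norm_num) (gC_pos K b.val)))

/-- `hlaw` — **THE ABSORPTION LAW WITH EQUALITY AT `A = 0`** [decided toy]: `4·gen b b = (1∕8)^(K−b) = βC K b + 0·Σ_∅` — W18's births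
sit ON the class, the dressing is the whole birth, nothing is absorbed. [folklore] -/
theorem absorbLaw_eq (K : ℕ) (b : (BC K).Birth) :
    4 * 1 / 1 * (TC K).gen b ((BC K).birthScale b) =
      βC K ((BC K).birthScale b) + 0 * ∑ b₀ ∈ (RsC K).absorbs b, (RsC K).pre b₀ ((BC K).birthScale b) := by
  show 4 * 1 / 1 * (if b.val = b.val then 3 * gC K b.val else 0) = βC K b.val + 0 * _
  rw [if_pos rfl, zero_mul, add_zero]
  unfold gC βC
  norm_num
  ring

/-- `hlaw` in S3u's letters. [folklore] -/
theorem absorbLaw_RsC (K : ℕ) : (TC K).AbsorbLaw (RsC K) (4 * 1 / 1) (βC K) 0 := fun b => (absorbLaw_eq K b).le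

/-- `hβ` with EQUALITY at `β₀ = 1`: the dressing IS `1·(2⁻¹^3)^(K−j)`. [folklore] -/
theorem hβ_A (K : ℕ) : ∀ j, j ≤ (BC K).K → βC K j ≤ 1 * ((2 : ℝ)⁻¹ ^ 3) ^ ((BC K).K - j) :=
  fun j _ => by rw [one_mul]; rfl

/-- `hfan` ∕ `hamp` at `A = 0`, `vR·mB = 1`, `ρ′ = ½`, `β₀ = A₀ = 1`: fan-out `0 < 1`, amplitude `1 ≤ 1` — TIGHT. [folklore] -/
theorem window_at_zero :
    fanout 0 (((1 : ℕ) : ℝ) * ((1 : ℕ) : ℝ)) (1 / 2) < 1 ∧ absorbAmplitude 1 0 (((1 : ℕ) : ℝ) * ((1 : ℕ) : ℝ)) (1 / 2) ≤ 1 := by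
  unfold absorbAmplitude fanout
  norm_num

/-! ## §4 THE END: row S3u §2's three supplied ENDs fire on `towerC` -/

/-- **THE SUPPLIED COMPOSITION END FIRES ON `towerC` AT `L = 2`** [decided toy]: (i) the supplier data are LIVE (multiplicity `1` and
component volume `1` ATTAINED, every capped live set HOUSED) AND (ii) `DressedStabilityStrict towerC ((2:ℝ)^4)` = row S3u §2's
`dressedStabilityStrict_of_suppliedComposition` BY NAME, ONE application: `hS`∕`hcount` READ OFF `anchC` (S3i inside S3u; `N₀ = v·mB = 1`
DERIVED — W18 posited it), `hbirth` READ THROUGH `RsC` (S5e inside S3u), `hsl`∕`hdefw`∕`hrate`∕`hlin` through S3u §1's socket fed by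
W20's `hG_C`∕`hVK_C`∕`hVrel_C`∕`hneX_C`∕`hsupX_C` via §1's bridge — at `L = 2, c_δ = r = w = 1, c̄ = 0, N₀ = A₀ = 1, m = ½, s̄⁰ = 0,
ρ′ = ½, θ = ¼, Lb = 2, v = mB = vR = 1, A = 0, β₀ = 1`.  Conjoined: the bare ROOT-C is W18's (`dedup.landed`). [folklore] -/
theorem suppliedComposition_fires :
    ((∀ K j, j ≤ K → ((BC K).births.filter fun b => (BC K).birthScale b = j ∧ (0 : Fin 4 → ℕ) ∈ (anchC K).dom b).card = 1) ∧
      (∀ K k, k ≤ K → ∀ b : (BC K).Birth, (compA K k b).card = 1) ∧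
      (∀ K k (b : (BC K).Birth), ∀ f ∈ SA K k b, ∃ q ∈ compA K k b, f ∈ (BC K).feltAt q)) ∧
    DressedStabilityStrict towerC ((2 : ℝ) ^ 4) := by
  refine ⟨⟨fun K j hj => hmult_attained K hj, fun K k hk b => hvol_attained K hk b, fun K => hhoused_A K⟩, ?_⟩
  exact dressedStabilityStrict_of_suppliedComposition towerC (fun _ K => anchC K) (fun _ K => RsC K)
    (L := 2) (cδ := 1) (cbar := 0) (N₀ := 1) (A₀ := 1) (m := 1 / 2) (sbar := 0) (ρ' := 1 / 2) (θ := 1 / 4) (A := 0) (β₀ := 1)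
    (mB := 1) (v := 1) (vR := 1)
    (move := fun U d t : ℂ => U + t * d) (N := fun d : ℂ => ‖d‖) (w := 1) (r := 1)
    (moveX := fun U d t : ℂ => U + t * d) (NX := fun d : ℂ => ‖d‖)
    (G := fun _ K b k' => FnC K b k' k') (rel := fun _ _ _ _ U U' => U = U') (𝒦 := fun _ _ _ _ => closedBall (0 : ℂ) 1)
    (V := fun _ _ _ k' k => vmap k' k) (𝒦X := fun _ _ _ => closedBall (0 : ℂ) 1) (relX := fun _ _ _ U U' => U = U')
    (δX := fun _ _ _ => (1 : ℝ)) (c := fun _ _ _ => 0) (s₀ := fun _ _ _ _ => 0) (S := fun _ K => SA K)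
    (comp := fun _ K => compA K) (β := fun _ K => βC K)
    (by norm_num) zero_le_one one_pos le_rfl zero_le_one zero_le_one (by norm_num)
    (by unfold locOf; norm_num) (by norm_num) (by norm_num)
    (by norm_num) (by norm_num)
    (fun _ _ _ => zero_le_one) (fun _ _ _ => le_rfl) (fun _ _ _ => le_rfl)
    (fun _ K => hG_A K) (fun _ K b k' => hinv_C K b k' k') (fun U d => by simp)
    (fun _ K => hneX_A K) (fun _ K => hsupX_A K)
    (fun _ _ _ => le_rfl) (fun _ _ _ _ => le_rfl) (fun _ _ _ _ => le_rfl) (fun _ K => hreg_A K)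
    (by norm_num) (fun _ K => hmult_A K) (fun _ K => hscale_A K) (fun _ K => hhoused_A K) (fun _ K => hvol_A K) (by norm_num)
    (fun _ K => compVol_RsC K) (fun _ K => preBelowEnv_RsC K _) le_rfl (fun _ K => absorbLaw_RsC K) (fun _ K => hβ_A K)
    window_at_zero.1 window_at_zero.2
    (fun _ K => hVK_C K) (fun _ K => hVrel_C K)

/-- [folklore] The bare ROOT-C OF RECORD through the supplied END (closed statement = W18's `dressedStabilityStrict_towerC`). -/
example : DressedStabilityStrict towerC ((2 : ℝ) ^ 4) := suppliedComposition_fires.2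

/-- [folklore] **THE HEADLINE END FIRES**: row S3u §2's `dressedStability_of_suppliedComposition` BY NAME, ONE application, same data. -/
example : DressedStability towerC :=
  dressedStability_of_suppliedComposition towerC (fun _ K => anchC K) (fun _ K => RsC K)
    (L := 2) (cδ := 1) (cbar := 0) (N₀ := 1) (A₀ := 1) (m := 1 / 2) (sbar := 0) (ρ' := 1 / 2) (θ := 1 / 4) (A := 0) (β₀ := 1)
    (mB := 1) (v := 1) (vR := 1)
    (move := fun U d t : ℂ => U + t * d) (N := fun d : ℂ => ‖d‖) (w := 1) (r := 1)
    (moveX := fun U d t : ℂ => U + t * d) (NX := fun d : ℂ => ‖d‖)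
    (G := fun _ K b k' => FnC K b k' k') (rel := fun _ _ _ _ U U' => U = U') (𝒦 := fun _ _ _ _ => closedBall (0 : ℂ) 1)
    (V := fun _ _ _ k' k => vmap k' k) (𝒦X := fun _ _ _ => closedBall (0 : ℂ) 1) (relX := fun _ _ _ U U' => U = U')
    (δX := fun _ _ _ => (1 : ℝ)) (c := fun _ _ _ => 0) (s₀ := fun _ _ _ _ => 0) (S := fun _ K => SA K)
    (comp := fun _ K => compA K) (β := fun _ K => βC K)
    (by norm_num) zero_le_one one_pos le_rfl zero_le_one zero_le_one (by norm_num)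
    (by unfold locOf; norm_num) (by norm_num) (by norm_num)
    (by norm_num) (by norm_num)
    (fun _ _ _ => zero_le_one) (fun _ _ _ => le_rfl) (fun _ _ _ => le_rfl)
    (fun _ K => hG_A K) (fun _ K b k' => hinv_C K b k' k') (fun U d => by simp)
    (fun _ K => hneX_A K) (fun _ K => hsupX_A K)
    (fun _ _ _ => le_rfl) (fun _ _ _ _ => le_rfl) (fun _ _ _ _ => le_rfl) (fun _ K => hreg_A K)
    (by norm_num) (fun _ K => hmult_A K) (fun _ K => hscale_A K) (fun _ K => hhoused_A K) (fun _ K => hvol_A K) (by norm_num)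
    (fun _ K => compVol_RsC K) (fun _ K => preBelowEnv_RsC K _) le_rfl (fun _ K => absorbLaw_RsC K) (fun _ K => hβ_A K)
    window_at_zero.1 window_at_zero.2
    (fun _ K => hVK_C K) (fun _ K => hVrel_C K)

/-- [folklore] **THE ROOT-B END FIRES**: row S3u §2's `dressedBudget_of_suppliedComposition` BY NAME, ONE application — for nonnegative
cube weights bounded by `w̄`, `DressedBudget towerC wt`, the bookings' positional count read off the SAME anchoring (`1 ≤ v = 1`). -/
example {wt : Unit → ℕ → ℕ → ℝ} {wbar : ℝ} (hwbar : 0 ≤ wbar) (hw0 : ∀ p K, ∀ j ≤ K, 0 ≤ wt p K j)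
    (hwb : ∀ p K, ∀ j ≤ K, wt p K j ≤ wbar) : DressedBudget towerC wt :=
  dressedBudget_of_suppliedComposition towerC (fun _ K => anchC K) (fun _ K => RsC K)
    (L := 2) (cδ := 1) (cbar := 0) (N₀ := 1) (A₀ := 1) (m := 1 / 2) (sbar := 0) (ρ' := 1 / 2) (θ := 1 / 4) (A := 0) (β₀ := 1)
    (mB := 1) (v := 1) (vR := 1)
    (move := fun U d t : ℂ => U + t * d) (N := fun d : ℂ => ‖d‖) (w := 1) (r := 1)
    (moveX := fun U d t : ℂ => U + t * d) (NX := fun d : ℂ => ‖d‖)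
    (G := fun _ K b k' => FnC K b k' k') (rel := fun _ _ _ _ U U' => U = U') (𝒦 := fun _ _ _ _ => closedBall (0 : ℂ) 1)
    (V := fun _ _ _ k' k => vmap k' k) (𝒦X := fun _ _ _ => closedBall (0 : ℂ) 1) (relX := fun _ _ _ U U' => U = U')
    (δX := fun _ _ _ => (1 : ℝ)) (c := fun _ _ _ => 0) (s₀ := fun _ _ _ _ => 0) (S := fun _ K => SA K)
    (comp := fun _ K => compA K) (β := fun _ K => βC K)
    (by norm_num) zero_le_one one_pos le_rfl zero_le_one zero_le_one (by norm_num)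
    (by unfold locOf; norm_num) (by norm_num) (by norm_num)
    (by norm_num) (by norm_num)
    (fun _ _ _ => zero_le_one) (fun _ _ _ => le_rfl) (fun _ _ _ => le_rfl)
    (fun _ K => hG_A K) (fun _ K b k' => hinv_C K b k' k') (fun U d => by simp)
    (fun _ K => hneX_A K) (fun _ K => hsupX_A K)
    (fun _ _ _ => le_rfl) (fun _ _ _ _ => le_rfl) (fun _ _ _ _ => le_rfl) (fun _ K => hreg_A K)
    (by norm_num) (fun _ K => hmult_A K) (fun _ K => hscale_A K) (fun _ K => hhoused_A K) (fun _ K => hvol_A K) (by norm_num)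
    (fun _ K => compVol_RsC K) (fun _ K => preBelowEnv_RsC K _) le_rfl (fun _ K => absorbLaw_RsC K) (fun _ K => hβ_A K)
    window_at_zero.1 window_at_zero.2
    (fun _ K => hVK_C K) (fun _ K => hVrel_C K)
    hwbar hw0 hwb le_rfl

/-! ## §5 THE ABSORPTION DOOR IS CLOSED ON `towerC` — BY THEOREM: any supplier data feeding row S3u §2 on W18's datum carry a
WEIGHTLESS absorption term -/

/-- **`1 ≤ mB` IS FORCED** [bookkeeping on the toy]: for ANY anchoring of `BC K` and any multiplicity bound `mB`, the oldest family is
felt at the scale-`0` cube, so (`felt_under`) it has a domain block, at which the scale-`0` multiplicity is `≥ 1`. [folklore] -/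
theorem one_le_mB_of_anchoring (K : ℕ) {Lb : ℕ} (An : Anchoring (BC K) 4 Lb) {mB : ℕ}
    (hmult : ∀ j (x : Fin 4 → ℕ), ((BC K).births.filter fun b => (BC K).birthScale b = j ∧ x ∈ An.dom b).card ≤ mB) :
    1 ≤ mB := by
  obtain ⟨x, hx, -⟩ := An.felt_under (⟨0, Nat.succ_pos K⟩ : Fin (K + 1)) (⟨0, Nat.succ_pos K⟩ : Fin (K + 1))
    (mem_filter.mpr ⟨Finset.mem_univ (⟨0, Nat.succ_pos K⟩ : Fin (K + 1)), le_rfl⟩)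
  exact le_trans (Finset.one_le_card.mpr ⟨⟨0, Nat.succ_pos K⟩, mem_filter.mpr ⟨(BC K).mem_births _, rfl, hx⟩⟩) (hmult 0 x)

/-- **`1 ≤ v` IS FORCED** [bookkeeping on the toy]: any components HOUSING the capped live sets have a cube at step `0` (the oldest
family is live there), so the component volume bound is `≥ 1`. Hence `N₀ ≥ v·mB ≥ 1` in row S3u §2 on this datum. [folklore] -/
theorem one_le_v_of_housing (K : ℕ) {comp : ℕ → (BC K).Birth → Finset (BC K).Cube} {v : ℕ}
    (hhoused : ∀ k b, ∀ f ∈ SA K k b, ∃ q ∈ comp k b, f ∈ (BC K).feltAt q) (hvol : ∀ k b, (comp k b).card ≤ v) :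
    1 ≤ v := by
  obtain ⟨q, hq, -⟩ := hhoused 0 ⟨0, Nat.succ_pos K⟩ ⟨0, Nat.succ_pos K⟩
    (by rw [SA_of_le (Nat.zero_le K)]; exact mem_filter.mpr ⟨Finset.mem_univ (⟨0, Nat.succ_pos K⟩ : Fin (K + 1)), le_rfl⟩)
  exact le_trans (Finset.one_le_card.mpr ⟨q, hq⟩) (hvol 0 _)

/-- **`1 ≤ β₀` IS FORCED** [bookkeeping on the toy]: for ANY ℝ-step datum over `BC K`, the absorption law at W18's transport constant
and the dressing-size bound `β j ≤ β₀·(2⁻¹)³^(K−j)` force `β₀ ≥ 1` — the OLDEST family `⟨0⟩` absorbs nobody (`RStep.absorbs_lt`) and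
W18's births sit ON the class: `4·gen ⟨0⟩ 0 = (1∕8)^K ≤ β 0 ≤ β₀·(1∕8)^K`. [folklore] -/
theorem beta0_ge_one_of_absorbLaw (K : ℕ) (R : RStep (BC K)) {β : ℕ → ℝ} {A β₀ : ℝ}
    (hlaw : (TC K).AbsorbLaw R (4 * 1 / 1) β A)
    (hβ : ∀ j, j ≤ (BC K).K → β j ≤ β₀ * ((2 : ℝ)⁻¹ ^ 3) ^ ((BC K).K - j)) : 1 ≤ β₀ := by
  have hempty : R.absorbs (⟨0, Nat.succ_pos K⟩ : Fin (K + 1)) = ∅ :=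
    Finset.eq_empty_of_forall_notMem fun b hb => Nat.not_lt_zero _ (R.absorbs_lt _ b hb)
  have h1 := hlaw ⟨0, Nat.succ_pos K⟩
  rw [hempty, Finset.sum_empty, mul_zero, add_zero] at h1
  have h3 : 4 * 1 / 1 * (TC K).gen (⟨0, Nat.succ_pos K⟩ : Fin (K + 1)) 0 = ((2 : ℝ)⁻¹ ^ 3) ^ (K - 0) := by
    show 4 * 1 / 1 * (if (0 : ℕ) = 0 then 3 * gC K 0 else 0) = ((2 : ℝ)⁻¹ ^ 3) ^ (K - 0)
    rw [if_pos rfl]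
    unfold gC
    norm_num
    ring
  have hpos : 0 < ((2 : ℝ)⁻¹ ^ 3) ^ (K - 0) := by positivity
  have h4 : 1 * ((2 : ℝ)⁻¹ ^ 3) ^ (K - 0) ≤ β₀ * ((2 : ℝ)⁻¹ ^ 3) ^ (K - 0) := by
    rw [one_mul]
    exact (h3.symm.le.trans h1).trans (hβ 0 (Nat.zero_le _))
  exact le_of_mul_le_mul_right h4 hpos

/-- **`A₀ ≤ 1` IS FORCED** [arith]: W18's PINNED gate scalars in row S3u §2's letters — source factor `m = ½`, margins `s₀ ≡ 0` (so
`0 ≤ s̄⁰` by `hs₀`), located largeness `locOf 2 1 4 c̄ ≤ ρ′ < 1` with `0 ≤ c̄` (so `½ ≤ ρ′`) — and `1 ≤ N₀` (`v·mB ≤ N₀` with the two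
lemmas above) turn the (w6) window `m·(N₀·A₀·(1−ρ′)⁻¹) ≤ 1 − s̄⁰` into `A₀ ≤ 1`: W18's window is TIGHT. [folklore] -/
theorem A0_le_one_of_window {N₀ A₀ ρ' sbar cbar : ℝ} (hN₀ : 1 ≤ N₀) (hA₀ : 0 ≤ A₀) (hcbar : 0 ≤ cbar)
    (hloc : locOf 2 1 (4 * 1 / 1) cbar ≤ ρ') (hρ'1 : ρ' < 1) (hsbar : 0 ≤ sbar)
    (hsmall : 1 / 2 * (N₀ * A₀ * (1 - ρ')⁻¹) ≤ 1 - sbar) : A₀ ≤ 1 := by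
  have hc : (0 : ℝ) ≤ 2 * (4 * 1 / 1) * cbar := by positivity
  have hρ : 1 / 2 ≤ ρ' := by unfold locOf at hloc; linarith
  have h1ρ : 0 < 1 - ρ' := by linarith
  have hinv : (2 : ℝ) ≤ (1 - ρ')⁻¹ := by
    rw [show (2 : ℝ) = (1 / 2)⁻¹ by norm_num]
    exact inv_anti₀ h1ρ (by linarith)
  have h3 : N₀ * A₀ * 2 ≤ N₀ * A₀ * (1 - ρ')⁻¹ := mul_le_mul_of_nonneg_left hinv (mul_nonneg (by linarith) hA₀)
  have h4 : A₀ ≤ N₀ * A₀ := le_mul_of_one_le_left hA₀ hN₀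
  linarith

/-- **THE ABSORPTION TERM IS WEIGHTLESS** [arith]: row S5b's located window (`fanout A N ρ′ < 1`, `absorbAmplitude β₀ A N ρ′ ≤ A₀`)
with `A₀ ≤ 1 ≤ β₀` (the two lemmas above) forces `A·N = 0` — the absorption constant or the count `N = vR·mB` vanishes (`vR = 0` empties
every component, hence `absorbs` by `absorbs_felt`): on W18's datum EVERY ℝ-step feeding row S3u §2 carries a WEIGHTLESS absorbed mass;
a genuine (γ)-side absorption witness needs births strictly INSIDE the class with window ROOM. [folklore] -/
theorem absorption_weightless {A N ρ' β₀ A₀ : ℝ} (hA : 0 ≤ A) (hN : 0 ≤ N) (hρ'1 : ρ' < 1)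
    (hfan : fanout A N ρ' < 1) (hamp : absorbAmplitude β₀ A N ρ' ≤ A₀) (hA₀ : A₀ ≤ 1) (hβ₀ : 1 ≤ β₀) : A * N = 0 := by
  have hinvpos : 0 < (1 - ρ')⁻¹ := inv_pos.mpr (by linarith)
  have hf0 : 0 ≤ fanout A N ρ' := by unfold fanout; positivity
  have h1 : 0 < 1 - fanout A N ρ' := by linarith
  have h2 : β₀ ≤ A₀ * (1 - fanout A N ρ') := by
    unfold absorbAmplitude at hamp
    rwa [div_le_iff₀ h1] at hamp
  have h3 : A₀ * (1 - fanout A N ρ') ≤ 1 * (1 - fanout A N ρ') := mul_le_mul_of_nonneg_right hA₀ h1.le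
  have h4 : fanout A N ρ' = 0 := le_antisymm (by linarith) hf0
  unfold fanout at h4
  rcases mul_eq_zero.mp h4 with h | h
  · exact h
  · exact absurd h hinvpos.ne'

/-- [folklore] §5 IN ACTION: at `N = 1`, `ρ′ = ½`, `A₀ = β₀ = 1`, W13's `A = 1∕8` FAILS S5b's amplitude test (`4∕3 > 1`); `A = 0` is TIGHT. -/
example : ¬ absorbAmplitude 1 (1 / 8) 1 (1 / 2) ≤ 1 := by
  unfold absorbAmplitude fanout
  norm_num

end Summit.QuantumFields.BalabanUV.T4Continuum.NE1p.DressedSuppliedCompositionWitness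

end
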